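import Summits.FinalStateConjecture.FinalStateConjecture.Theses.PhaseMixingCapture
import Summits.FinalStateConjecture.FinalStateConjecture.Theorems.NearExtremalKappaCapture.Negative.ExponentMonotonicity
import Summits.FinalStateConjecture.FinalStateConjecture.Theorems.PhaseMixingCaptureNearExtremalKappaCaptureBackgroundUniform
import Literature.Geometry.Lorentzian.Sweep2
import Literature.Geometry.Lorentzian.HorizonPenetratingTeukolsky

/-!
# Skeleton line `polynomial-closure` for crux `NearExtremalKappaCapture` (stmt-FinalStateConjecture-10606)
# — rev 3 (lead reshape, 2026-08-16): stubs 1/3 retyped as the SLAB law on the horizon-penetrating chart,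
#   mass-locally-uniform constant, transfer hypothesis on a PARAMETER BOX (drefute g1 + g2 integrated)

Route `PhaseMixingCapture`, crux rank 2 `NearExtremalKappaCapture` =
`∀ [Kerr.Facts] [Kerr.SliceFacts], ∃ (s δ k γ p a₁), a₁ < 1 ∧ CaptureWith s δ k γ p a₁`
(`Negative.ExponentMonotonicity.near_iff`, `Iff.rfl`): κ-explicit nonlinear capture of the spins
`a₁M ≤ |a| < M` — basin `c(M)·χ^γ` in the weighted Sobolev distance to the Kerr datum on the
Kerr–Schild slice `{t* = 0, r > M}`, far-complete `𝓘⁺`, `C^k` convergence to a SUB-extremal Kerr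
`g_{M',a'}`, modulus `|M' − M| + |a' − a| ≤ C(M)·χ^{−p}·√dist`, `χ = 1 − (a/M)² ≍ (κM)²`.
Planner skeleton: crux-plan round 1 (planner-cruxplan-stmt-FinalStateConjecture-10606-polynomial-closure-0);
idea card `Ideas/polynomial-closure.md`; lead: prover-line-stmt-FinalStateConjecture-10606-0 (PICKED.md).

## The line: polynomial in ⇒ polynomial out

The crux tolerates ANY fixed powers of `χ` (admissible exponent vectors form an up-set, `captureWith_mono`;
only super-polynomial degeneration refutes it, `not_near_iff`). The card's audit closes every door through
which a super-polynomial loss could enter a nonlinear Kerr-stability proof but one: (α) CLOSING IS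
POLYNOMIAL (continuity / Nash–Moser thresholds are MONOMIALS in the input constants), (β) THE BACKGROUND
NEVER DEGENERATES (the Kerr–Schild family is jointly smooth in `(a, x)` on `{r > 0}` through `a = M`),
(γ) MARGINS ARE TAME — so the nonlinear crux TRANSFERS to a κ-polynomial LINEAR spin-±2 law `C⁺` on EXACT
Kerr. Stubs:

* `stub_kappaPolynomialTeukolskySlabLaw` — `C⁺` (XL, OPEN, HARDEST, lead): the DHRT (1.3)-format SLAB law
  (boundedness + integrated local energy decay in one restartable inequality, sourced pairs `𝔗α = F`, NO
  support condition) for spin `±2` on the horizon-penetrating chart `Kerr.region a M = {r > M}` of EXACT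
  near-extremal Kerr, at ONE regularity `(k, w)` chosen before the mass scale, with constant
  `C(M₀, R)·χ^{−p}`, `p ≥ 0`, `C ≥ 1` LOCALLY UNIFORM in the mass `M ∈ [M₀/2, 2M₀]`.
* `stub_backgroundUniform` — leg (β): CLOSED (landed p77983,
  `Theorems/PhaseMixingCaptureNearExtremalKappaCaptureBackgroundUniform.lean`).
* `stub_polynomialClosingBox` — leg (α), the TRANSFER (XL, crux-sized as a TRACKED statement): for every
  linear regularity `(k, w)` there are `(s, δ, kc, N, γ₀)` such that for every `M > 0` there are
  `(R, n, c₀ > 0, C₀ ≥ 0)` with: for every sub-extremal spin `a` and all `Λ, B ≥ 1`, the slab law with ONE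
  constant `Λ` at EVERY parameter pair of the box `|M' − M| + |a' − a| ≤ Mχ/8` (each on its own chart
  `Kerr.region a' M'`; the box stays sub-extremal with `χ/3 ≤ χ'`, `box_bounds`) and the background bound `B`
  give capture at `(M, a)` with basin `c₀·χ^{γ₀}·((ΛB)^N)⁻¹` and modulus `C₀·χ^{−γ₀}·(ΛB)^N` (conclusion =
  VERBATIM the crux body at one spin, `CaptureAt`; `captureWith_iff` is `Iff.rfl`).

`NearExtremalKappaCapture_of` composes the two open stub STATEMENTS and the landed leg (β) into the crux BY NAME
(kernel-checked, no `sorry` of its own): crux threshold `a₁' := (2a₁ + 1)/3`, box constant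
`Λ(a) := (C₁3^p)·χ^{−p} ≥ C₁·χ'^{−p}` on the box (`box_bounds`), `c := c₀·((C₁3^pB)^N)⁻¹`, `C := C₀·(C₁3^pB)^N`,
`γ = p_crux := γ₀ + pN` (`basin_coeff_eq`, `modulus_coeff_eq`). POLYNOMIAL IN ⇒ POLYNOMIAL OUT.

## Rev 2/3 — what changed and why (lead, integrating wave 1 + the drefuter's g1/g2 `stub-misstated` notes)

* `stub_backgroundUniform`: LANDED (worker, p77983) — imported and used below, no `sorry`.
* Stubs 1 and 3 RETYPED IN TANDEM (drefute notes `DrefuteNoteStubKappaPolynomialTeukolskyLaw.md`,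
  `DrefuteNoteStubPolynomialClosing.md`, vocabulary `DrefuteCorrected.lean`, 2026-08-16): the rev-1
  hypothesis `TeukolskyLawAt` quantified over `Kerr.IsAdmissibleTeukolskyField` — the OPEN exterior
  `{r > r₊}` with data compactly supported in the OPEN leaf `{t* = 0, r > r₊}`. That class has zero Cauchy
  trace on the horizon sphere; the closure `X` of `C_c^∞({r > r₊})` data in the `H^k`-energy space (`k ≥ 1`)
  misses every datum with non-zero trace (trace map continuous, vanishes on `X`; Mazur), so a law over it
  bounds the solution operator uniformly in `τ` on `X` ONLY, while the crux's perturbations live on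
  `Kerr.slice a M = {t* = 0, r > M} ⊋ {r ≥ r₊}` and generically have non-zero horizon trace (cut-offs cost
  `e^{(2k−1)κτ}` by domain of dependence). Hence `Λ` of rev 1 could not enter the transfer's near-horizon
  rows (T.i/T.ii) and "all κ-content isolated in `C⁺`" failed BY TYPE. Rev 2 states `C⁺` and the transfer's
  hypothesis over admissible SOURCED pairs on the horizon-penetrating chart `Kerr.region a M` (inhomogeneous
  DHRT (1.3) format; SR–TdC arXiv:2302.08916 Thm A p. 3 is printed in exactly this class). The vocabulary
  (`Kerr.teukolskyOpOn`, `Kerr.IsTeukolskyPairOnSlab`, `Kerr.TeukolskySlabLawOn`, `Kerr.teukolskyEnergyOn`, …) is proposed to the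
  tree as `Literature/Geometry/Lorentzian/HorizonPenetratingTeukolsky.lean` (landed; imported here).
* Rev 3 (drefute g2 notes `DrefuteG2Note*.md`, vocabulary `DrefuteG2Corrected.lean`): (F2, parameter drift)
  capture lands on `Kerr(M', a') ≠ Kerr(M, a)` and a black-box law does not transport across a stationary
  parameter shift without an uncompensated top-order loss (DHRT arXiv:2212.14093 p. 6 close top order with the
  DECAY of the perturbation), so the transfer now assumes the law with ONE `Λ` on the PARAMETER BOX
  `|M' − M| + |a' − a| ≤ Mχ/8`, and `C⁺` delivers a constant LOCALLY UNIFORM in the mass (`M ∈ [M₀/2, 2M₀]`;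
  scaling); (F3) the law is typed on SLABS with sources and NO support condition (restartable inside a
  bootstrap; an inner-edge support condition is not invariant under the evolution on the penetrating chart).
  The composition absorbs the box by real arithmetic (`box_bounds`: the box lies in `[M/2, 2M] × {a₁M' ≤ |a'|}`,
  stays sub-extremal, and `χ' ≥ χ/3`, so `C₁χ'^{−p} ≤ (C₁3^p)χ^{−p}`).
* `C⁺` (stub 1″) is STRONGER than rev 1/2 on paper (slab + sourced + no support ⊇ Cauchy-anchored classes;
  `Kerr.IsAdmissibleTeukolskyField.fieldOn` proves the exterior class sits inside the penetrating one) and the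
  transfer correspondingly weaker; a super-polynomial near-horizon loss has nowhere to live but `C⁺` — the
  advertised localisation holds by type.
* Worker verdict on the transfer (wave 1, audit file `work/stubs/stub_polynomialClosing.lean`, rc 0): neither
  junk-true nor junk-false (`dataWeightedSobolevEDist_self = 0` puts the centre in every basin, so the stub
  pins every MGHD of exact Kerr data; `IsMaximal`, `IsNormalisedNullRayFrom`, `ConvergesToKerr` honest); no
  existing named fact closes or nearly closes it (nearest: `Literature.Barriers.FinalStateConjecture.
  SlowlyRotatingKerrFrontierNarrow` = pointwise `(ε, C)(M, a)`, no χ-rate, unasserted). It is crux-sized.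

## Disproof used (`Cruxes/NearExtremalKappaCapture/Disproof.lean` v4, cdisprove; verdict there: NO KILL)

* §0 `near_iff` (landed `Negative/ExponentMonotonicity`, p73006) — USED: the composition enters the crux
  through it; `captureWith_iff` certifies `CaptureAt` is VERBATIM the crux body at one spin.
* §2 up-set / `near_iff_diagonal` / `not_near_iff` — HONOURED: output exponents are the monomials
  `γ = p = γ₀ + pN`; ¬line = super-polynomial loss, the disprover's normal form.
* §3 `captureWith_self` — CONSISTENT: at `dist = 0` the transfer's modulus pins `(M', a') = (M, a)`.
* §4/§9 third-law fork (order one: `γ < 1` dies modulo `ThresholdTrap 1`), `Negative/TruncationTraps`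
  (`γ ≥ θ` per trap order; nothing for `δ ≥ 1/2`), `Negative/SubextremalRedundancy` (`IsSubextremal M' a'`
  free given the modulus) — HONOURED: `(s, δ, γ₀)` are the transfer's EXISTENTIAL outputs, nothing pins a
  small weight or basin exponent; the transfer keeps the `IsSubextremal M' a'` conjunct (free anyway).
* §5/`Negative/ExtremalGerm` (`near_iff_germ`): the content is the RATE at the extremal germ — exactly what
  `χ^{−p}` in `C⁺` and `χ^{±γ₀}` in the transfer track.
* No `-- Targets` theorem kills a stub of this line; drefute verdicts: stub 2 survived (landed), stubs 1/3
  `stub-misstated` ⇒ reshaped here.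
-/

noncomputable section

set_option linter.dupNamespace false

namespace Summit.FinalStateConjecture.FinalStateConjecture.Cruxes.NearExtremalKappaCapture.PolynomialClosure

open Literature.Geometry.Lorentzian
open Summit.FinalStateConjecture.FinalStateConjecture.Theorems.NearExtremalKappaCapture.Negative
open scoped Manifold ContDiff Topology ENNReal
open Set Filter MeasureTheory


/-! ### The statements of the line (named `Prop`s) -/

/-- **`C⁺ = KappaPolynomialTeukolskySlabLaw` (statement of STUB 1″).** There are `a₁ < 1`, a loss exponent
`p ≥ 0` and ONE regularity `(k, w)` — all chosen before the mass scale — such that for every `M₀ > 0` and every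
radius `R` there is `C = C(M₀, R) ≥ 1` with: for every mass `M ∈ [M₀/2, 2M₀]` and every spin `a₁M ≤ |a| < M`
the slab law `Kerr.TeukolskySlabLawOn M a M k w R Λ` (DHRT (1.3) format on the crux's own chart `{r > M}`)
holds with `Λ = C·(1 − (a/M)²)^{−p}`. Negation = for some `(k, w, R)` the best constant grows faster than
every power of `χ⁻¹` as `|a| → M` (the route's KILL CRITERION at spin `±2`). -/
def KappaPolynomialTeukolskySlabLaw : Prop :=
  ∀ [Kerr.Facts], ∃ a₁ : ℝ, a₁ < 1 ∧ ∃ (p : ℝ) (k : ℕ) (w : ℝ), 0 ≤ p ∧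
    ∀ M₀ : ℝ, 0 < M₀ → ∀ R : ℝ, ∃ C : ℝ, 1 ≤ C ∧ ∀ M : ℝ, M₀ / 2 ≤ M → M ≤ 2 * M₀ →
      ∀ a : ℝ, a₁ * M ≤ |a| → Kerr.IsSubextremal M a →
        Kerr.TeukolskySlabLawOn M a M k w R (C * (1 - (a / M) ^ 2) ^ (-p))

/-- **Background bound at one spin** (leg (β) at `(M, a)`): on the box `{x⁰ = 0, M ≤ r_a(x) ≤ R}` every joint
`(a, x)`-derivative of order `j ≤ n` of `(a, x) ↦ H_{M,a}(x)` (`Kerr.scalarH`) and of `(a, x) ↦ ℓ_μ(a, x)`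
(`Kerr.nullCovectorFun`) has operator norm `≤ B`. -/
def BackgroundBoundAt (M a : ℝ) (n : ℕ) (R B : ℝ) : Prop :=
  ∀ x : E4, x 0 = 0 → M ≤ Kerr.radius a x → Kerr.radius a x ≤ R → ∀ j : ℕ, j ≤ n →
    ‖iteratedFDeriv ℝ j (fun q : ℝ × E4 ↦ Kerr.scalarH M q.1 q.2) (a, x)‖ ≤ B ∧
      ∀ μ : Fin 4, ‖iteratedFDeriv ℝ j (fun q : ℝ × E4 ↦ Kerr.nullCovectorFun q.1 q.2 μ) (a, x)‖ ≤ B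

/-- **`BackgroundUniform` (leg (β); statement of STUB 2, CLOSED).** For `0 < M`, every `n` and `R` there is
ONE `B ≥ 1` with `BackgroundBoundAt M a n R B` for EVERY `|a| ≤ M`. -/
def BackgroundUniform : Prop :=
  ∀ M : ℝ, 0 < M → ∀ (n : ℕ) (R : ℝ), ∃ B : ℝ, 1 ≤ B ∧ ∀ a : ℝ, |a| ≤ M →
    BackgroundBoundAt M a n R B

/-- **Capture at one spin with basin radius `ρ` and modulus constant `L`** — VERBATIM the body of the crux
(`CaptureWith`) at a fixed `(M, a)` with the two κ-dependent constants made real parameters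
(`captureWith_iff` is `Iff.rfl`). -/
def CaptureAt [Kerr.Facts] [Kerr.SliceFacts] (s : ℕ) (δ : ℝ) (k : ℕ) {M : ℝ} (hM : 0 < M)
    (a ρ L : ℝ) : Prop :=
  ∀ (D : InitialDataSet 𝓘(ℝ, E3) (Kerr.slice a M)) [D.metric.HasLeviCivita],
    D.IsVacuumConstraintSolution →
      InitialDataSet.dataWeightedSobolevEDist s δ D (Kerr.data M a M hM.le) < ENNReal.ofReal ρ →
        ∀ 𝒟 : VacuumCauchyDevelopment D, 𝒟.IsMaximal →
          ∃ (M' a' : ℝ) (𝒟oc : Set 𝒟.carrier), Kerr.IsSubextremal M' a' ∧ FarComplete 𝒟 ∧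
            𝒟.toSpacetime.ConvergesToKerr 𝒟oc M' a' k ∧
              |M' - M| + |a' - a| ≤
                L * √(InitialDataSet.dataWeightedSobolevEDist s δ D (Kerr.data M a M hM.le)).toReal

/-- **`PolynomialClosingBox` (leg (α), the TRANSFER `C⁺ ⇒ crux`; statement of STUB 3″).** For every linear
regularity `(k, w)` there are `(s, δ, kc, N, γ₀)` such that for every `M > 0` there are
`(R, n, c₀ > 0, C₀ ≥ 0)` with: for every sub-extremal spin `a` and all `Λ, B ≥ 1`, the slab law with ONE
constant `Λ` at EVERY parameter pair `(M', a')` of the box `|M' − M| + |a' − a| ≤ Mχ/8` (each on its own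
chart `Kerr.region a' M'`) and the background bound `B` at `(M, a)` give capture at `(M, a)` with basin
`c₀·χ^{γ₀}·((ΛB)^N)⁻¹` and modulus `C₀·χ^{−γ₀}·(ΛB)^N`, `χ = 1 − (a/M)²`. -/
def PolynomialClosingBox : Prop :=
  ∀ [Kerr.Facts] [Kerr.SliceFacts], ∀ (k : ℕ) (w : ℝ),
    ∃ (s : ℕ) (δ : ℝ) (kc : ℕ) (N : ℕ) (γ₀ : ℝ), ∀ (M : ℝ) (hM : 0 < M),
      ∃ (R : ℝ) (n : ℕ) (c₀ : ℝ), 0 < c₀ ∧ ∃ C₀ : ℝ, 0 ≤ C₀ ∧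
        ∀ a : ℝ, Kerr.IsSubextremal M a → ∀ Λ B : ℝ, 1 ≤ Λ → 1 ≤ B →
          (∀ M' a' : ℝ, |M' - M| + |a' - a| ≤ M * (1 - (a / M) ^ 2) / 8 →
              Kerr.TeukolskySlabLawOn M' a' M' k w R Λ) →
            BackgroundBoundAt M a n R B →
              CaptureAt s δ kc hM a (c₀ * (1 - (a / M) ^ 2) ^ γ₀ * ((Λ * B) ^ N)⁻¹)
                (C₀ * (1 - (a / M) ^ 2) ^ (-γ₀) * (Λ * B) ^ N)

/-- **Read-back certificate.** `CaptureWith s δ k γ p a₁` (the crux body at a fixed exponent vector, `near_iff`)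
is BY DEFINITION "for every `M > 0` some `c > 0`, `C` give `CaptureAt` at every spin `a₁M ≤ |a| < M` with basin
`c·χ^γ` and modulus `C·χ^{−p}`". -/
theorem captureWith_iff [Kerr.Facts] [Kerr.SliceFacts] (s : ℕ) (δ : ℝ) (k : ℕ) (γ p a₁ : ℝ) :
    CaptureWith s δ k γ p a₁ ↔ ∀ (M : ℝ) (hM : 0 < M), ∃ c > (0 : ℝ), ∃ C : ℝ, ∀ a : ℝ,
      a₁ * M ≤ |a| → Kerr.IsSubextremal M a →
        CaptureAt s δ k hM a (c * (1 - (a / M) ^ 2) ^ γ) (C * (1 - (a / M) ^ 2) ^ (-p)) :=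
  Iff.rfl

/-! ### The registered stubs (statements expanded over the vocabulary) -/

/-- STUB 1″ (XL, OPEN, HARDEST; lead) — `KappaPolynomialTeukolskySlabLaw` = `C⁺`, expanded: κ-polynomial
DHRT-format slab law for sourced spin-`±2` Teukolsky pairs on the horizon-penetrating chart `{r > M}` of EXACT
near-extremal Kerr, constant `C(M₀, R)·χ^{−p}` locally uniform in the mass. Why plausibly true: every printed
near-extremal transient is polynomial in `κ⁻¹` (zero-damped modes `κ^{−1/2}…κ^{−1}`, Gralla–Zimmerman–Zimmerman
2016, damping `≍ κ` uniformly in `(ℓ, m)`; spherical charged analogue UNIFORM with transient up to `v ~ κ⁻¹`,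
AKU arXiv:2603.10378 Thm 1/4); the real-axis Wronskian floor is explicit and uniform on `|a| ≤ M` on bounded
frequency boxes (TdC CMP 378 (2020) Prop 6.3); the printed sub-extremal theorem is in the horizon-crossing
class (SR–TdC arXiv:2302.08916 Thm A), without rate; mass-local uniformity is scaling (cost
`max(M/M₀, M₀/M)^{O(k+|w|)}` from the inhomogeneous weights). Why it might fail: no rate as `a₀ → M` in print;
at `κ = 0` finite-regularity boundedness of non-axisymmetric fields is expected false (AKU p. 16; Gajic
arXiv:2302.06636 Rem 1.3(3)); the threshold cone `{|ω − mω₊| ≲ |m|κ^θ, |m| → ∞}` could carry a Gevrey /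
`e^{c/κ}` price (the ONLY shape of a kill, `not_near_iff`). Shared with the sibling crux `KappaExplicitWaveDecay`
(stmt-FinalStateConjecture-10654) at spin `±2`. -/
theorem stub_kappaPolynomialTeukolskySlabLaw :
    ∀ [Kerr.Facts], ∃ a₁ : ℝ, a₁ < 1 ∧ ∃ (p : ℝ) (k : ℕ) (w : ℝ), 0 ≤ p ∧
      ∀ M₀ : ℝ, 0 < M₀ → ∀ R : ℝ, ∃ C : ℝ, 1 ≤ C ∧ ∀ M : ℝ, M₀ / 2 ≤ M → M ≤ 2 * M₀ →
        ∀ a : ℝ, a₁ * M ≤ |a| → Kerr.IsSubextremal M a →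
          Kerr.TeukolskySlabLawOn M a M k w R (C * (1 - (a / M) ^ 2) ^ (-p)) := by
  sorry

/-- STUB 2 — CLOSED (landed p77983, `Theorems.NearExtremalKappaCapture.PolynomialClosure.stub_backgroundUniform`):
`BackgroundUniform`, expanded. -/
theorem stub_backgroundUniform :
    ∀ M : ℝ, 0 < M → ∀ (n : ℕ) (R : ℝ), ∃ B : ℝ, 1 ≤ B ∧ ∀ a : ℝ, |a| ≤ M →
      ∀ x : E4, x 0 = 0 → M ≤ Kerr.radius a x → Kerr.radius a x ≤ R → ∀ j : ℕ, j ≤ n →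
        ‖iteratedFDeriv ℝ j (fun q : ℝ × E4 ↦ Kerr.scalarH M q.1 q.2) (a, x)‖ ≤ B ∧
          ∀ μ : Fin 4,
            ‖iteratedFDeriv ℝ j (fun q : ℝ × E4 ↦ Kerr.nullCovectorFun q.1 q.2 μ) (a, x)‖ ≤ B :=
  Theorems.NearExtremalKappaCapture.PolynomialClosure.stub_backgroundUniform

/-- STUB 3″ (XL, crux-sized as a TRACKED statement; the TRANSFER) — `PolynomialClosingBox`, expanded: from the
slab law with ONE constant `Λ` on the parameter box `|M' − M| + |a' − a| ≤ Mχ/8` and the background bound `B`,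
capture at `(M, a)` with basin `c₀·χ^{γ₀}·((ΛB)^N)⁻¹` and modulus `C₀·χ^{−γ₀}·(ΛB)^N`. Known only qualitatively
(some basin, some modulus) at every FIXED `|a| < M` (Hintz arXiv:2606.28253 Thm 1.1, unrefereed) and for
`|a| ≪ M` (Klainerman–Szeftel 2023 / GKS arXiv:2205.14808, modulus `C√dist`); nothing in the tree closes or
nearly closes it (wave-1 audit). Internal rows: (T.i) slab law ⇒ `r`-weighted outgoing-null-slab form; (T.ii)
non-Teukolsky parts of the linearised system (transport / elliptic / gauge, background-and-red-shift constants
`χ^{−O(1)}`); (T.iii) monomial Nash–Moser / bootstrap threshold incl. structural stability of trapping and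
radial-point estimates under `C^N`-perturbation; (T.iv) contour at `Im σ ≥ −c₀κ` (κ-free derivative COUNT);
(T.v) modulation to the final parameters INSIDE the box (drift `≤ Mχ/4` by the modulus, `SubextremalRedundancy`)
/ final-parameter modulus. -/
theorem stub_polynomialClosingBox :
    ∀ [Kerr.Facts] [Kerr.SliceFacts], ∀ (k : ℕ) (w : ℝ),
      ∃ (s : ℕ) (δ : ℝ) (kc : ℕ) (N : ℕ) (γ₀ : ℝ), ∀ (M : ℝ) (hM : 0 < M),
        ∃ (R : ℝ) (n : ℕ) (c₀ : ℝ), 0 < c₀ ∧ ∃ C₀ : ℝ, 0 ≤ C₀ ∧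
          ∀ a : ℝ, Kerr.IsSubextremal M a → ∀ Λ B : ℝ, 1 ≤ Λ → 1 ≤ B →
            (∀ M' a' : ℝ, |M' - M| + |a' - a| ≤ M * (1 - (a / M) ^ 2) / 8 →
                Kerr.TeukolskySlabLawOn M' a' M' k w R Λ) →
            (∀ x : E4, x 0 = 0 → M ≤ Kerr.radius a x → Kerr.radius a x ≤ R → ∀ j : ℕ, j ≤ n →
              ‖iteratedFDeriv ℝ j (fun q : ℝ × E4 ↦ Kerr.scalarH M q.1 q.2) (a, x)‖ ≤ B ∧
                ∀ μ : Fin 4,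
                  ‖iteratedFDeriv ℝ j (fun q : ℝ × E4 ↦ Kerr.nullCovectorFun q.1 q.2 μ) (a, x)‖ ≤
                    B) →
            ∀ (D : InitialDataSet 𝓘(ℝ, E3) (Kerr.slice a M)) [D.metric.HasLeviCivita],
              D.IsVacuumConstraintSolution →
                InitialDataSet.dataWeightedSobolevEDist s δ D (Kerr.data M a M hM.le) <
                    ENNReal.ofReal (c₀ * (1 - (a / M) ^ 2) ^ γ₀ * ((Λ * B) ^ N)⁻¹) →
                  ∀ 𝒟 : VacuumCauchyDevelopment D, 𝒟.IsMaximal →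
                    ∃ (M' a' : ℝ) (𝒟oc : Set 𝒟.carrier), Kerr.IsSubextremal M' a' ∧
                      FarComplete 𝒟 ∧ 𝒟.toSpacetime.ConvergesToKerr 𝒟oc M' a' kc ∧
                        |M' - M| + |a' - a| ≤
                          C₀ * (1 - (a / M) ^ 2) ^ (-γ₀) * (Λ * B) ^ N *
                            √(InitialDataSet.dataWeightedSobolevEDist s δ D
                                (Kerr.data M a M hM.le)).toReal := by
  sorry

/-! ### Consistency: each named statement IS its registered stub (definitionally) -/

theorem kappaPolynomialTeukolskySlabLaw_holds : KappaPolynomialTeukolskySlabLaw :=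
  stub_kappaPolynomialTeukolskySlabLaw
theorem backgroundUniform_holds : BackgroundUniform := stub_backgroundUniform
theorem polynomialClosingBox_holds : PolynomialClosingBox := stub_polynomialClosingBox

/-! ### Name-keyed aliases of the open statements (hypotheses of the composition) -/
namespace Registered

/-- Alias of `KappaPolynomialTeukolskySlabLaw` keyed by the registered stub name. -/
abbrev stub_kappaPolynomialTeukolskySlabLaw : Prop := KappaPolynomialTeukolskySlabLaw
/-- Alias of `PolynomialClosingBox` keyed by the registered stub name. -/
abbrev stub_polynomialClosingBox : Prop := PolynomialClosingBox

end Registered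

/-! ### Glue (PROVED): box arithmetic, monotonicity and the exponent bookkeeping -/

/-- **The parameter box of the transfer.** For `0 < M`, `|a| < M` with `(2a₁ + 1)/3 · M ≤ |a|`, `a₁ < 1`,
every `(M', a')` with `|M' − M| + |a' − a| ≤ Mχ/8` (`χ = 1 − (a/M)²`) satisfies: `M/2 ≤ M' ≤ 2M` (mass scale
of `C⁺` at `M₀ = M`), `a₁M' ≤ |a'|` (inside the near-extremal range of `C⁺`), `|a'| < M'` (sub-extremal) and
`χ/3 ≤ χ' = 1 − (a'/M')²` (so `C₁χ'^{−p} ≤ C₁3^pχ^{−p}`). Key: `Mχ ≤ 2(M − |a|)`, the box radius is at most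
`(M − |a|)/4`, and `M − |a| ≤ 2M(1 − a₁)/3`. -/
theorem box_bounds {M a M' a' a₁ : ℝ} (hM : 0 < M) (hsub : Kerr.IsSubextremal M a) (ha₁ : a₁ < 1)
    (ha : (2 * a₁ + 1) / 3 * M ≤ |a|) (hbox : |M' - M| + |a' - a| ≤ M * (1 - (a / M) ^ 2) / 8) :
    M / 2 ≤ M' ∧ M' ≤ 2 * M ∧ a₁ * M' ≤ |a'| ∧ Kerr.IsSubextremal M' a' ∧
      (1 - (a / M) ^ 2) / 3 ≤ 1 - (a' / M') ^ 2 := by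
  have haM : |a| < M := hsub
  set u : ℝ := M - |a| with hu
  have hu0 : 0 < u := by rw [hu]; linarith
  -- `Mχ = u (M + |a|)/M ∈ [u, 2u]`
  have hchi : M * (1 - (a / M) ^ 2) = u * ((M + |a|) / M) := by
    rw [hu, div_pow, ← sq_abs a]; field_simp; ring
  have hchi2 : M * (1 - (a / M) ^ 2) ≤ 2 * u := by
    rw [hchi]
    have : (M + |a|) / M ≤ 2 := by rw [div_le_iff₀ hM]; linarith
    exact (mul_le_mul_of_nonneg_left this hu0.le).trans_eq (by ring)
  have hchi1 : u ≤ M * (1 - (a / M) ^ 2) := by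
    rw [hchi]
    have : 1 ≤ (M + |a|) / M := by rw [le_div_iff₀ hM]; linarith [abs_nonneg a]
    exact (le_mul_of_one_le_right hu0.le this)
  have hd : |M' - M| + |a' - a| ≤ u / 4 := by linarith
  have h1 : |M' - M| ≤ u / 4 := by linarith [abs_nonneg (a' - a)]
  have h2 : |a' - a| ≤ u / 4 := by linarith [abs_nonneg (M' - M)]
  have hM'lo : M - u / 4 ≤ M' := by linarith [neg_abs_le (M' - M)]
  have hM'hi : M' ≤ M + u / 4 := by linarith [le_abs_self (M' - M)]
  have huM : u ≤ M := by rw [hu]; linarith [abs_nonneg a]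
  have ha'lo : |a| - u / 4 ≤ |a'| := by
    have : |a| ≤ |a'| + |a' - a| := by
      calc |a| = |a' - (a' - a)| := by ring_nf
        _ ≤ |a'| + |a' - a| := abs_sub _ _
    linarith
  have ha'hi : |a'| ≤ |a| + u / 4 := by
    have : |a'| ≤ |a| + |a' - a| := by
      calc |a'| = |a + (a' - a)| := by ring_nf
        _ ≤ |a| + |a' - a| := abs_add_le _ _
    linarith
  have hM'pos : 0 < M' := by linarith
  obtain ⟨hχ0, hχ1⟩ := kappaSq_pos_le_one hsub
  have hM'le : M' ≤ 9 / 8 * M := by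
    have e1 : M * (1 - (a / M) ^ 2) / 8 ≤ M / 8 := by nlinarith
    have e2 : |M' - M| ≤ M / 8 := by linarith [abs_nonneg (a' - a)]
    linarith [le_abs_self (M' - M)]
  have hgap : 3 * u / 4 ≤ M' - |a'| := by
    have e1 : |a'| ≤ |a| + |a' - a| := by
      calc |a'| = |a + (a' - a)| := by ring_nf
        _ ≤ |a| + |a' - a| := abs_add_le _ _
    have e2 := neg_abs_le (M' - M)
    rw [hu]
    linarith
  refine ⟨by linarith, by linarith, ?_, ?_, ?_⟩
  · -- near-extremal range: `a₁ M' ≤ |a'|`, using `u ≤ 2M(1 − a₁)/3`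
    have hua : u ≤ 2 * M * (1 - a₁) / 3 := by rw [hu]; linarith
    rcases le_or_gt a₁ 0 with ha₁0 | ha₁0
    · exact (mul_nonpos_of_nonpos_of_nonneg ha₁0 hM'pos.le).trans (abs_nonneg a')
    · have hkey : a₁ * (M + u / 4) ≤ |a| - u / 4 := by
        rw [hu] at hua ⊢
        nlinarith
      calc a₁ * M' ≤ a₁ * (M + u / 4) := mul_le_mul_of_nonneg_left hM'hi ha₁0.le
        _ ≤ |a| - u / 4 := hkey
        _ ≤ |a'| := ha'lo
  · -- sub-extremal: `M' − |a'| ≥ 3u/4 > 0`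
    show |a'| < M'
    linarith
  · -- `χ' ≥ χ/3`: `χ' ≥ (M' − |a'|)/M' ≥ (3u/4)/(9M/8)` and `χ ≤ 2u/M`
    have hchi' : (M' - |a'|) / M' ≤ 1 - (a' / M') ^ 2 := by
      rw [div_pow, ← sq_abs a', div_le_iff₀ hM'pos]
      have ha'0 : 0 ≤ |a'| := abs_nonneg a'
      have hlt : |a'| < M' := by linarith
      have e : (1 - |a'| ^ 2 / M' ^ 2) * M' = (M' - |a'|) * ((M' + |a'|) / M') := by
        field_simp; ring
      rw [e]
      have : 1 ≤ (M' + |a'|) / M' := by rw [le_div_iff₀ hM'pos]; linarith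
      exact le_mul_of_one_le_right (by linarith) this
    have hstep : (1 - (a / M) ^ 2) / 3 ≤ (M' - |a'|) / M' := by
      rw [div_le_div_iff₀ (by norm_num : (0:ℝ) < 3) hM'pos]
      have e0 : (1 - (a / M) ^ 2) * M ≤ 2 * u := by linarith [hchi2]
      have e1 : (1 - (a / M) ^ 2) * M' ≤ (1 - (a / M) ^ 2) * (9 / 8 * M) :=
        mul_le_mul_of_nonneg_left hM'le hχ0.le
      linarith
    exact hstep.trans hchi'

/-- The background bound is monotone in its constant. -/
theorem backgroundBoundAt_mono {M a : ℝ} {n : ℕ} {R B B' : ℝ} (h : BackgroundBoundAt M a n R B)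
    (hB : B ≤ B') : BackgroundBoundAt M a n R B' := by
  intro x hx0 hx1 hx2 j hj
  obtain ⟨h1, h2⟩ := h x hx0 hx1 hx2 j hj
  exact ⟨h1.trans hB, fun μ ↦ (h2 μ).trans hB⟩

/-- Capture is monotone: a smaller basin and a larger modulus constant are weaker. -/
theorem captureAt_mono [Kerr.Facts] [Kerr.SliceFacts] {s : ℕ} {δ : ℝ} {k : ℕ} {M : ℝ}
    {hM : 0 < M} {a ρ ρ' L L' : ℝ} (h : CaptureAt s δ k hM a ρ L) (hρ : ρ' ≤ ρ) (hL : L ≤ L') :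
    CaptureAt s δ k hM a ρ' L' := by
  intro D _ hvac hdist 𝒟 hmax
  obtain ⟨M', a', 𝒟oc, hsub, hfar, hconv, hmod⟩ :=
    h D hvac (hdist.trans_le (ENNReal.ofReal_le_ofReal hρ)) 𝒟 hmax
  exact ⟨M', a', 𝒟oc, hsub, hfar, hconv,
    hmod.trans (mul_le_mul_of_nonneg_right hL (Real.sqrt_nonneg _))⟩

/-- The slab law is consistent and its class non-empty: the zero pair is a sourced pair on every slab with
vanishing energies, so `Kerr.TeukolskySlabLawOn M a M k w R Λ` holds AT the zero pair for every `Λ`. -/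
example [Kerr.Facts] (M a : ℝ) [(Kerr.metric M a M).HasLeviCivita] (spin : ℤ) (τ₀ τ₁ : ℝ) :
    Kerr.IsTeukolskyPairOnSlab M a M spin τ₀ τ₁ (fun _ ↦ 0) (fun _ ↦ 0) ∧
      ∀ τ k w A, Kerr.teukolskyEnergyOn M a M spin (fun _ ↦ 0) τ k w A = 0 :=
  ⟨Kerr.isTeukolskyPairOnSlab_zero M a M spin τ₀ τ₁,
    fun τ k w A ↦ Kerr.teukolskyEnergyOn_zero M a M spin τ k w A⟩

/-- `(x ^ (−p)) ^ N = x ^ (−(pN))` for `x ≥ 0`. -/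
theorem rpow_neg_pow_natCast {x : ℝ} (hx : 0 ≤ x) (p : ℝ) (N : ℕ) :
    (x ^ (-p)) ^ N = x ^ (-(p * N)) := by
  rw [← Real.rpow_natCast, ← Real.rpow_mul hx]
  congr 1
  ring

/-- The basin bookkeeping: `c₀ ((C₁B)^N)⁻¹ · χ^(γ₀ + pN) = c₀ χ^γ₀ · ((C₁ χ^(−p) B)^N)⁻¹`. -/
theorem basin_coeff_eq {χ c₀ C₁ B γ₀ p : ℝ} (hχ : 0 < χ) (N : ℕ) :
    c₀ * ((C₁ * B) ^ N)⁻¹ * χ ^ (γ₀ + p * N) =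
      c₀ * χ ^ γ₀ * ((C₁ * χ ^ (-p) * B) ^ N)⁻¹ := by
  rw [Real.rpow_add hχ, mul_pow, mul_pow, mul_pow, rpow_neg_pow_natCast hχ.le,
    Real.rpow_neg hχ.le (p * N)]
  have ht : χ ^ (p * N) ≠ 0 := (Real.rpow_pos_of_pos hχ _).ne'
  field_simp

/-- The modulus bookkeeping: `C₀ χ^(−γ₀) (C₁ χ^(−p) B)^N = C₀ (C₁B)^N · χ^(−(γ₀ + pN))`. -/
theorem modulus_coeff_eq {χ C₀ C₁ B γ₀ p : ℝ} (hχ : 0 < χ) (N : ℕ) :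
    C₀ * χ ^ (-γ₀) * (C₁ * χ ^ (-p) * B) ^ N = C₀ * (C₁ * B) ^ N * χ ^ (-(γ₀ + p * N)) := by
  rw [mul_pow, mul_pow, mul_pow, rpow_neg_pow_natCast hχ.le,
    show -(γ₀ + p * N) = -γ₀ + -(p * N) by ring, Real.rpow_add hχ]
  ring

/-- On the box, the κ-factor at `(M', a')` is dominated: `χ'^{−p} ≤ 3^p χ^{−p}` for `p ≥ 0`, `χ/3 ≤ χ'`. -/
theorem rpow_neg_le_of_third_le {χ χ' p : ℝ} (hχ : 0 < χ) (hp : 0 ≤ p) (h : χ / 3 ≤ χ') :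
    χ' ^ (-p) ≤ (3 : ℝ) ^ p * χ ^ (-p) := by
  have h3 : 0 < χ / 3 := by positivity
  calc χ' ^ (-p) ≤ (χ / 3) ^ (-p) := Real.rpow_le_rpow_of_nonpos h3 h (neg_nonpos.mpr hp)
    _ = (3 : ℝ) ^ p * χ ^ (-p) := by
        rw [Real.div_rpow hχ.le (by norm_num), Real.rpow_neg (by norm_num : (0:ℝ) ≤ 3),
          Real.rpow_neg hχ.le]
        have h3p : (3 : ℝ) ^ p ≠ 0 := (Real.rpow_pos_of_pos (by norm_num) p).ne'
        have hχp : χ ^ p ≠ 0 := (Real.rpow_pos_of_pos hχ p).ne'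
        field_simp

/-! ### The composition: the stubs imply the crux, by name -/

/-- **`NearExtremalKappaCapture` from the two OPEN stub statements and the LANDED leg (β)** (real arithmetic,
no `sorry`). Take `(a₁, p, k, w)` from `C⁺` and `(s, δ, kc, N, γ₀)` from the transfer at that `(k, w)`; the
crux's exponent vector is `(s, δ, kc, γ₀ + pN, γ₀ + pN, (2a₁ + 1)/3)`. For `M > 0` take `(R, n, c₀, C₀)` from
the transfer, `C₁ = C(M₀ := M, R)` from `C⁺`, `B = B(M, n, R)` from the landed `stub_backgroundUniform`, put
`C₁' := C₁3^p`, `c := c₀ ((C₁'B)^N)⁻¹ > 0`, `C := C₀ (C₁'B)^N`. At a spin `(2a₁+1)M/3 ≤ |a| < M` the box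
constant is `Λ := C₁' χ^{−p} ≥ 1`: by `box_bounds` every `(M', a')` of the box has `M' ∈ [M/2, 2M]`,
`a₁M' ≤ |a'| < M'` and `χ' ≥ χ/3`, so `C⁺` gives the slab law there with `C₁χ'^{−p} ≤ Λ`
(`rpow_neg_le_of_third_le`, `TeukolskySlabLawOn.mono`); the transfer at `(a, Λ, B)` is capture with basin
`c χ^{γ₀+pN}` (`basin_coeff_eq`) and modulus `C χ^{−(γ₀+pN)}` (`modulus_coeff_eq`). -/
theorem NearExtremalKappaCapture_of (hL : Registered.stub_kappaPolynomialTeukolskySlabLaw)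
    (hT : Registered.stub_polynomialClosingBox) :
    Theses.PhaseMixingCapture.NearExtremalKappaCapture := by
  refine near_iff.mpr ?_
  intro hF hS
  have hB : BackgroundUniform := stub_backgroundUniform
  obtain ⟨a₁, ha₁, p, k, w, hp, hlaw⟩ := @hL hF
  obtain ⟨s, δ, kc, N, γ₀, hTk⟩ := @hT hF hS k w
  refine ⟨s, δ, kc, γ₀ + p * N, γ₀ + p * N, (2 * a₁ + 1) / 3, by linarith, ?_⟩
  intro M hM
  obtain ⟨R, n, c₀, hc₀, C₀, hC₀, hTM⟩ := hTk M hM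
  obtain ⟨C₁, hC₁, hlawM⟩ := hlaw M hM R
  obtain ⟨B, hB1, hBM⟩ := hB M hM n R
  have h3p : 1 ≤ (3 : ℝ) ^ p := Real.one_le_rpow (by norm_num) hp
  set C₁' : ℝ := C₁ * (3 : ℝ) ^ p with hC₁'
  have hC₁'1 : 1 ≤ C₁' := by rw [hC₁']; nlinarith
  have hC₁'0 : 0 < C₁' := by linarith
  have hB0 : 0 < B := by linarith
  refine ⟨c₀ * ((C₁' * B) ^ N)⁻¹, by positivity, C₀ * (C₁' * B) ^ N, ?_⟩
  intro a ha hsub D inst hvac hdist 𝒟 hmax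
  obtain ⟨hχ0, hχ1⟩ := kappaSq_pos_le_one hsub
  set χ : ℝ := 1 - (a / M) ^ 2 with hχdef
  -- the box constant at this spin, `Λ = C₁' χ^{-p} ≥ 1`
  have hχp : 1 ≤ χ ^ (-p) := Real.one_le_rpow_of_pos_of_le_one_of_nonpos hχ0 hχ1 (by linarith)
  have hΛ1 : 1 ≤ C₁' * χ ^ (-p) := by nlinarith
  -- the slab law on the whole box with the one constant `Λ`
  have hboxlaw : ∀ M' a' : ℝ, |M' - M| + |a' - a| ≤ M * (1 - (a / M) ^ 2) / 8 →
      Kerr.TeukolskySlabLawOn M' a' M' k w R (C₁' * χ ^ (-p)) := by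
    intro M' a' hbox
    obtain ⟨hlo, hhi, ha', hsub', hχ'⟩ := box_bounds hM hsub ha₁ ha hbox
    have hlaw' : Kerr.TeukolskySlabLawOn M' a' M' k w R (C₁ * (1 - (a' / M') ^ 2) ^ (-p)) :=
      hlawM M' hlo hhi a' ha' hsub'
    have hle : C₁ * (1 - (a' / M') ^ 2) ^ (-p) ≤ C₁' * χ ^ (-p) :=
      calc C₁ * (1 - (a' / M') ^ 2) ^ (-p) ≤ C₁ * ((3 : ℝ) ^ p * χ ^ (-p)) :=
            mul_le_mul_of_nonneg_left (rpow_neg_le_of_third_le hχ0 hp hχ') (by linarith)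
        _ = C₁' * χ ^ (-p) := by rw [hC₁']; ring
    exact @Kerr.TeukolskySlabLawOn.mono hF M' a' M' k w R _ _ hlaw' hle
  have haM : |a| ≤ M := le_of_lt hsub
  have hcap := hTM a hsub (C₁' * χ ^ (-p)) B hΛ1 hB1 hboxlaw (hBM a haM)
  have hdist' : InitialDataSet.dataWeightedSobolevEDist s δ D (Kerr.data M a M hM.le) <
      ENNReal.ofReal (c₀ * χ ^ γ₀ * ((C₁' * χ ^ (-p) * B) ^ N)⁻¹) := by
    rwa [basin_coeff_eq hχ0 N] at hdist
  obtain ⟨M', a', 𝒟oc, hsub', hfar, hconv, hmod⟩ := hcap D hvac hdist' 𝒟 hmax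
  refine ⟨M', a', 𝒟oc, hsub', hfar, hconv, ?_⟩
  rwa [modulus_coeff_eq hχ0 N] at hmod

/-- Wiring check: the registered stubs feed `NearExtremalKappaCapture_of` as stated. -/
example : Theses.PhaseMixingCapture.NearExtremalKappaCapture :=
  NearExtremalKappaCapture_of stub_kappaPolynomialTeukolskySlabLaw stub_polynomialClosingBox

end Summit.FinalStateConjecture.FinalStateConjecture.Cruxes.NearExtremalKappaCapture.PolynomialClosure

end
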